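import Summits.Langlands.Langlands.Theses.InsolubleResidueReduction
import Summits.Langlands.Langlands.Theorems.LevelOneDyadicResidue
import Literature.NumberTheory.GaloisRepresentations.ArtinRestriction

/-!
# NonLiftableResidueReduction — «the minimal counterexample to insoluble-residue automorphy has a residue that lifts to NO Artin representation» (decomp-langlands, lens 4 «minimal counterexample / extremal reduction», gen 15; RESIDUAL MODE)

TARGET. INS = `Summit.Langlands.Langlands.Theses.InsolubleResidueReduction.InsolubleResidueAutomorphy` (stmt-Langlands-27765; crux r2, OPEN,
the DECLARED RESIDUAL of route-Langlands-InsolubleResidueReduction rev 0 — the lens-4 g14 child of MinimalLevelDescent rev 3 at B₂ 27523; tree twin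
`LevelOneDyadic.Residue.InsolubleResidueAutomorphy`, same text, `insolubleResidueAutomorphy_route_iff_twin : _ ↔ _ := Iff.rfl`): every irreducible
pinned-geometric ρ : Γ_K → GL_n(ℚ̄₂) unramified away from 2 whose semisimple residual representation τ = ρ̄^ss has INSOLUBLE image is RESIDUALLY automorphic.

CONSTRUCTION (one dial, one excluded middle, 0 sorry). DIAL `IsArtinLiftableResidue ρ` := «some residual representation τ of ρ is also the residual
representation of a FINITE-IMAGE IRREDUCIBLE σ : Γ_K → GL_n(ℚ̄₂)» (an ARTIN AVATAR of the residue; no level or parity condition on σ). Cells: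
* LART `LiftableResidueAutomorphy` (crux r3, NEW, ATTACKABLE NOW) = INS ∧ dial;
* NLR `NonLiftableResidueAutomorphy` (crux r2, NEW, the DECLARED RESIDUAL) = INS ∧ ¬dial;
* FRAME″ `InsolubleResidueFrame` (support r9) = `InsolubleResidueReduction.InsolubleResidueAutomorphy → Langlands` (the parent route below INS).
KERNEL I `insolubleResidueAutomorphy_iff_cells : INS ↔ (LART ∧ NLR)` (EXACT; `dial_disjoint`: the cells are disjoint). KERNEL II necessity from the summit through the
landed tower (`liftable_of_langlands`, `nonLiftable_of_langlands`, `frame_of_host` from the parent's AB/SOL/FRAME binders, `frame_of_grandhost`, `insolubleStrongArtin_of_langlands`).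
KERNEL III′ THE REDUCTION `liftableResidueAutomorphy_of_strongArtin : InsolubleStrongArtin → LART` (PROVED): the Artin avatar σ has insoluble image because the residue has
(`isSolvable_range_of_isResidualRepOf` ⇐ `ker_le_ker_of_isResidualRepOf`, proved: an integral model that is trivial at g forces σ g = 1, so im τ is a quotient of im σ);
strong Artin makes σ automorphic; automorphic ⇒ residually automorphic (`LevelOneDyadic.isResiduallyAutomorphic_of_satakeCompatible`, tree); residual automorphy passes from
σ to ρ along the common τ (KERNEL III of the twin, `Residue.isResiduallyAutomorphic_of_sharedResidual`, tree). `insolubleStrongArtin_of_ranks` splits the line predicate by rank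
(n ≤ 2 icosahedral / n ≥ 3), `liftableResidueAutomorphy_of_line` composes. KERNEL IV `nonLiftableResidueAutomorphy_of_birth` (NLR from NLR_irr ∧ NLR_red by absolute irreducibility of
the residue), `rung_of_liftable` (the BC5 rung is an instance of LART). KERNEL V `closes_framed`, `closes` (= the parent's `closes` with INS assembled from the cells), `closes_host`
(ten grand-host binders), `rung_of_cells` (→ B₂ at (ℚ,2), `MinimalLevelDescent.DyadicLevelOneRankTwoQ`).

WHY STRICTLY WEAKER. LART, NLR ⟸ INS by forgetting the dial (`liftable_of_insoluble`, `nonLiftable_of_insoluble`); neither gives INS back (kit probes 3–6 fail: `exact h0`, `aesop`,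
`exact?`), nor the summit (probes 1–2), nor B₂ (12–13); each of the three binders of `closes` is load-bearing (drop-one probes 9–11 fail). FRAME″ is S-implied trivially and used toward S.

WHY NOVEL (problem-relative). g14 ordered counterexamples to B₂ by SOLUBILITY of the residual image and stopped at «insoluble» because Fong–Swan (Serre GTM 42 Thm 38) lifts
only p-soluble images to characteristic 0. g15 orders the insoluble residues by the NEXT invariant of modular representation theory — liftability of the 𝔽̄₂-representation τ of
im τ to characteristic 0 THROUGH Γ_K (Serre §16.3 conditions (R)/(R′), Ex. 16.7: they fail for SL₂-type groups) — and proves that a liftable insoluble residue is a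
CHARACTERISTIC-0 STRONG-ARTIN problem. RANK 2 IS DECIDED BY KLEIN–DICKSON: an insoluble irreducible τ : Γ_K → GL₂(𝔽̄₂) has image ⊇ SL₂(𝔽_(2^k)), k ≥ 2; k = 2 (projective image
A₅ = SL₂(𝔽₄), the ICOSAHEDRAL residue) is Artin-liftable — lift Γ_K → A₅ ⊂ PGL₂(ℂ) by Tate's H²(G_K, ℚ/ℤ) = 0 (Serre, Durham 1977 §6.5 Thm 4; tree named fact
`Tate_finiteProjectiveImage_eq_twist_finiteImage`) and twist by the Teichmüller lift of τ ⊗ σ̄₀⁻¹ —, k ≥ 3 is not (no finite subgroup of GL₂(ℂ) reduces onto SL₂(𝔽₈)). So rank-2 LART =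
the icosahedral mod-2 residues (Shepherd-Barron–Taylor 1997's objects, there over ℚ via abelian surfaces; PRINT mod W⁺ over totally real K for totally odd lifts: Pilloni–Stroh 2016
Thm 0.3, tree fact `pilloniStroh_strongArtin_of_isIcosahedralType`; BDST 2001; KW 2009) and rank-2 NLR = the Dembélé-type residues (SL₂(𝔽₂₅₆) over ℚ(ζ₃₂)⁺, automorphic by birth).
No cell of the decomp-langlands tree reads this dial: MonodromyDichotomy/DeligneSerreSplit's Artin cells ask finite (projective) image of ρ ITSELF; here ρ has infinite image and only an
avatar of its residue is Artin. Searches (corpus fts+vec, galaxy, citation graph, tree) in the kit card; nearest prior art Shepherd-Barron–Taylor 1997 [graph:doi:10.1090/s0894-0347-97-00226-9].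

ORBIT CLOSURE. The dial depends on ρ only through the isomorphism class of τ = ρ̄^ss (Brauer–Nesbitt) and is invariant under Teichmüller twists, duals and Frobenius of the
coefficients; LART/NLR are unions of INS-orbits. TYPING: the dial is an honest existential over (σ, τ) tied to ρ by `IsResidualRepOf` on both sides (`IsArtinLiftableResidue.exists_sharedResidual`),
so no junk inhabitant: LART ∪ NLR = INS and LART ∩ NLR = ∅ definitionally.

AXIOMS. Every kernel theorem depends on exactly [propext, Classical.choice, Quot.sound] (kit `.probes.lean` `#guard_msgs` ×17).
-/

set_option linter.dupNamespace false

namespace Summit.Langlands.Langlands.Theorems.LevelOneDyadic.Liftable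

open scoped NumberField
open Filter IsDedekindDomain Polynomial
open Literature.NumberTheory.GaloisRepresentations Literature.NumberTheory.Automorphic
open Summit.Langlands.Langlands.Theses
open Summit.Langlands.Langlands.Theorems.LevelOneDyadic
open Summit.Langlands.Langlands.Theorems.LevelOneDyadic.Residue

variable {K : Type} [Field K] [NumberField K] {ℓ : ℕ} [Fact ℓ.Prime] {n : ℕ}

/-! ## Vocabulary — the dial: is the semisimple residual representation τ of ρ ARTIN-LIFTABLE? -/

/-- ρ : Γ_K → GL_n(ℚ̄₂) has an ARTIN-LIFTABLE RESIDUE: some residual representation τ of ρ is also a residual representation of a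
FINITE-IMAGE IRREDUCIBLE 2-adic σ : Γ_K → GL_n(ℚ̄₂) — i.e. the 𝔽̄₂-representation τ = ρ̄^ss lifts IRREDUCIBLY to characteristic 0 through
some finite quotient of Γ_K (the decomposition-matrix reading of modular representation theory on im τ; σ = «an irreducible Artin
avatar of the residue»).  Invariant under GL_n(𝔽̄₂)-conjugation of τ (Brauer–Nesbitt), under twists of ρ by level-one characters
(twist σ by the Teichmüller lift), duals, Frobenius twists of the coefficients. [dial, ℓ = 2] -/
def IsArtinLiftableResidue (ρ : FramedGaloisRep K (PadicAlgCl 2) n) : Prop := (∃ (σ : Literature.NumberTheory.GaloisRepresentations.FramedGaloisRep K (PadicAlgCl 2) n) (τ : Field.absoluteGaloisGroup K →* GL (Fin n) (Literature.NumberTheory.GaloisRepresentations.padicAlgClResidueField 2)), (Set.range (fun g : Field.absoluteGaloisGroup K => σ g)).Finite ∧ σ.toGaloisRep.IsIrreducible ∧ ρ.IsResidualRepOf (RingHom.id (Literature.NumberTheory.GaloisRepresentations.padicAlgClResidueField 2)) τ ∧ σ.IsResidualRepOf (RingHom.id (Literature.NumberTheory.GaloisRepresentations.padicAlgClResidueField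 2)) τ)

/-! ## The pieces (filed texts, verbatim = the child route's items; INS = the born route decl, imported BY NAME) -/

/-- [crux LART · WEAKER(`liftable_of_insoluble`, `liftable_of_langlands`; no `LART → INS`: probes) · OPEN · ATTACKABLE-NOW — by KERNEL III
(residual automorphy is an invariant of τ) and `automorphic ⇒ residually automorphic` it REDUCES (`liftableResidueAutomorphy_of_strongArtin`)
to INSOLUBLE STRONG ARTIN in characteristic 0 (`InsolubleStrongArtin`, S-implied `insolubleStrongArtin_of_langlands`); PRINT sector:
totally odd icosahedral Artin lifts over totally real K (Pilloni–Stroh 2016; tree fact `pilloniStroh_strongArtin_of_isIcosahedralType`),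
their Sym²/Sym³/Sym⁴ (Gelbart–Jacquet, Kim–Shahidi, Kim); open: even icosahedral, PSL₂(7) ⊂ GL₃, rank ≥ 6]
INS for ρ whose residue is ARTIN-LIFTABLE. -/
def LiftableResidueAutomorphy : Prop := ∀ (K : Type) [Field K] [NumberField K] (n : ℕ) (hcpt : Literature.NumberTheory.Automorphic.isCompact_glFiniteIntegralLevel n K), 0 < n → ∀ (ι : PadicAlgCl 2 ≃+* ℂ) (ρ : Literature.NumberTheory.GaloisRepresentations.FramedGaloisRep K (PadicAlgCl 2) n), ρ.toGaloisRep.IsIrreducible → (∀ τ : Field.absoluteGaloisGroup K →* GL (Fin n) (Literature.NumberTheory.GaloisRepresentations.padicAlgClResidueField 2), ρ.IsResidualRepOf (RingHom.id (Literature.NumberTheory.GaloisRepresentations.padicAlgClResidueField 2)) τ → ¬ IsSolvable τ.range) → (∃ (σ : Literature.NumberTheory.GaloisRepresentations.FramedGaloisRep K (PadicAlgCl 2) n) (τ : Field.absoluteGaloisGroup K →* GL (Fin n) (Literature.NumberTheory.GaloisRepresentations.padicAlgClResidueField 2)), (Set.range (fun g : Field.absoluteGaloisGroup K => σ g)).Finite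 ∧ σ.toGaloisRep.IsIrreducible ∧ ρ.IsResidualRepOf (RingHom.id (Literature.NumberTheory.GaloisRepresentations.padicAlgClResidueField 2)) τ ∧ σ.IsResidualRepOf (RingHom.id (Literature.NumberTheory.GaloisRepresentations.padicAlgClResidueField 2)) τ) → ((∀ᶠ v : IsDedekindDomain.HeightOneSpectrum (NumberField.RingOfIntegers K) in cofinite, ρ.IsUnramifiedAt v) ∧ ∀ (v : IsDedekindDomain.HeightOneSpectrum (NumberField.RingOfIntegers K)) (hv : ((2 : ℕ) : NumberField.RingOfIntegers K) ∈ v.asIdeal), (Literature.NumberTheory.PAdicHodge.fontainePstAdicCompletion v 2 hv).IsDeRhamFramed (ρ.toLocal v)) → (∀ v : IsDedekindDomain.HeightOneSpectrum (NumberField.RingOfIntegers K), ((2 : ℕ) : NumberField.RingOfIntegers K) ∉ v.asIdeal → ρ.IsUnramifiedAt v) → ∃ π : Literature.NumberTheory.Automorphic.CuspidalAutomorphicRepData n K hcpt, π.1.IsLAlgebraic ∧ ∀ᶠ v : IsDedekindDomain.HeightOneSpectrum (NumberField.RingOfIntegers K) in cofinite, ρ.IsUnramifiedAt v ∧ (∃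 α : Multiset ℂ, π.1.HasSatakeParamAt v α) ∧ ∀ α : Multiset ℂ, π.1.HasSatakeParamAt v α → ∃ P Q : Polynomial (Valued.v : Valuation (PadicAlgCl 2) NNReal).valuationSubring, ρ.HasFrobCharpolyAt v (P.map (Valued.v : Valuation (PadicAlgCl 2) NNReal).valuationSubring.subtype) ∧ Literature.NumberTheory.Automorphic.arithFrobPolyOfSatake ι v.residueCard 1 α = Q.map (Valued.v : Valuation (PadicAlgCl 2) NNReal).valuationSubring.subtype ∧ P.map (IsLocalRing.residue (Valued.v : Valuation (PadicAlgCl 2) NNReal).valuationSubring) = Q.map (IsLocalRing.residue (Valued.v : Valuation (PadicAlgCl 2) NNReal).valuationSubring)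

/-- [crux NLR · DECLARED RESIDUAL · WEAKER(`nonLiftable_of_insoluble`, `nonLiftable_of_langlands`; no `NLR → INS`: the icosahedral /
liftable residues are outside it and open) · OPEN · INSTRUMENTABLE (liftability of an irreducible insoluble G-module over 𝔽̄₂ is a
finite decomposition-matrix computation: rank-2 content = im τ ⊇ SL₂(𝔽_(2^k)), k ≥ 3; known inhabitant Dembélé's SL₂(𝔽₂₅₆) over ℚ(ζ₃₂)⁺,
automorphic by birth) · birth skeleton NLR_irr (τ absolutely irreducible) ∧ NLR_red (τ reducible with an insoluble constituent and no
irreducible Artin lift: the insoluble Eisenstein residue)]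
INS for ρ whose residue is NOT Artin-liftable — the normal form of a minimal counterexample to INS: a genuinely non-Artin mod-2 residue. -/
def NonLiftableResidueAutomorphy : Prop := ∀ (K : Type) [Field K] [NumberField K] (n : ℕ) (hcpt : Literature.NumberTheory.Automorphic.isCompact_glFiniteIntegralLevel n K), 0 < n → ∀ (ι : PadicAlgCl 2 ≃+* ℂ) (ρ : Literature.NumberTheory.GaloisRepresentations.FramedGaloisRep K (PadicAlgCl 2) n), ρ.toGaloisRep.IsIrreducible → (∀ τ : Field.absoluteGaloisGroup K →* GL (Fin n) (Literature.NumberTheory.GaloisRepresentations.padicAlgClResidueField 2), ρ.IsResidualRepOf (RingHom.id (Literature.NumberTheory.GaloisRepresentations.padicAlgClResidueField 2)) τ → ¬ IsSolvable τ.range) → ¬ (∃ (σ : Literature.NumberTheory.GaloisRepresentations.FramedGaloisRep K (PadicAlgCl 2) n) (τ : Field.absoluteGaloisGroup K →* GL (Fin n) (Literature.NumberTheory.GaloisRepresentations.padicAlgClResidueField 2)), (Set.range (fun g : Field.absoluteGaloisGroup K => σ g)).Finite ∧ σ.toGaloisRep.IsIrreducible ∧ ρ.IsResidualRepOf (RingHom.id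 (Literature.NumberTheory.GaloisRepresentations.padicAlgClResidueField 2)) τ ∧ σ.IsResidualRepOf (RingHom.id (Literature.NumberTheory.GaloisRepresentations.padicAlgClResidueField 2)) τ) → ((∀ᶠ v : IsDedekindDomain.HeightOneSpectrum (NumberField.RingOfIntegers K) in cofinite, ρ.IsUnramifiedAt v) ∧ ∀ (v : IsDedekindDomain.HeightOneSpectrum (NumberField.RingOfIntegers K)) (hv : ((2 : ℕ) : NumberField.RingOfIntegers K) ∈ v.asIdeal), (Literature.NumberTheory.PAdicHodge.fontainePstAdicCompletion v 2 hv).IsDeRhamFramed (ρ.toLocal v)) → (∀ v : IsDedekindDomain.HeightOneSpectrum (NumberField.RingOfIntegers K), ((2 : ℕ) : NumberField.RingOfIntegers K) ∉ v.asIdeal → ρ.IsUnramifiedAt v) → ∃ π : Literature.NumberTheory.Automorphic.CuspidalAutomorphicRepData n K hcpt, π.1.IsLAlgebraic ∧ ∀ᶠ v : IsDedekindDomain.HeightOneSpectrum (NumberField.RingOfIntegers K) in cofinite, ρ.IsUnramifiedAt v ∧ (∃ α : Multiset ℂ, π.1.HasSatakeParamAt v α) ∧ ∀ α : Multiset ℂ,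 π.1.HasSatakeParamAt v α → ∃ P Q : Polynomial (Valued.v : Valuation (PadicAlgCl 2) NNReal).valuationSubring, ρ.HasFrobCharpolyAt v (P.map (Valued.v : Valuation (PadicAlgCl 2) NNReal).valuationSubring.subtype) ∧ Literature.NumberTheory.Automorphic.arithFrobPolyOfSatake ι v.residueCard 1 α = Q.map (Valued.v : Valuation (PadicAlgCl 2) NNReal).valuationSubring.subtype ∧ P.map (IsLocalRing.residue (Valued.v : Valuation (PadicAlgCl 2) NNReal).valuationSubring) = Q.map (IsLocalRing.residue (Valued.v : Valuation (PadicAlgCl 2) NNReal).valuationSubring)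

/-- [support FRAME″ · content = the born route-Langlands-InsolubleResidueReduction rev 0 VERBATIM below INS: `INS → Langlands`, i.e. its
three other deciding binders AB `AbelianResidueAutomorphy` 27766, SOL `SolubleResidueAutomorphy` 27767, FRAME `DyadicLevelOneFrame` 27768
through `InsolubleResidueReduction.closes` (certified `frame_of_host`); Langlands ⟹ FRAME″ trivially (`frame_of_langlands`).  Same device as
`InsolubleResidueReduction.DyadicLevelOneFrame` one level up.] -/
def InsolubleResidueFrame : Prop := Summit.Langlands.Langlands.Theses.InsolubleResidueReduction.InsolubleResidueAutomorphy → _root_.Langlands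

/-- [line predicate SAI, node-only · S-implied (`insolubleStrongArtin_of_langlands`) · = the two LART line stubs joined
(`insolubleStrongArtin_of_ranks`)] INSOLUBLE STRONG ARTIN in the summit's 2-adic normalisation: every finite-image irreducible
σ : Γ_K → GL_n(ℚ̄₂) with insoluble image is Satake–Frobenius compatible a.e. with an L-algebraic cuspidal π of GL_n(𝔸_K). -/
def InsolubleStrongArtin : Prop := ∀ (K : Type) [Field K] [NumberField K] (n : ℕ) (hcpt : Literature.NumberTheory.Automorphic.isCompact_glFiniteIntegralLevel n K), 0 < n → ∀ (ι : PadicAlgCl 2 ≃+* ℂ) (σ : Literature.NumberTheory.GaloisRepresentations.FramedGaloisRep K (PadicAlgCl 2) n), (Set.range (fun g : Field.absoluteGaloisGroup K => σ g)).Finite → σ.toGaloisRep.IsIrreducible → ¬ IsSolvable (MonoidHom.range (σ : Field.absoluteGaloisGroup K →* GL (Fin n) (PadicAlgCl 2))) → ∃ π : Literature.NumberTheory.Automorphic.CuspidalAutomorphicRepData n K hcpt, π.1.IsLAlgebraic ∧ ∀ᶠ v : IsDedekindDomain.HeightOneSpectrum (NumberField.RingOfIntegers K) in cofinite, Summit.Langlands.SatakeFrobCompatibleAt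 ι π.1 σ v

/-! ## Bridges — every filed text is the vocabulary form, definitionally (`Iff.rfl`) -/

/-- The born route decl INS (stmt-Langlands-27765) IS the tree twin's `Residue.InsolubleResidueAutomorphy` (same text). -/
theorem insolubleResidueAutomorphy_route_iff_twin :
    InsolubleResidueReduction.InsolubleResidueAutomorphy ↔ Residue.InsolubleResidueAutomorphy :=
  Iff.rfl

/-- INS (the born route decl) in vocabulary form. -/
theorem insolubleResidueAutomorphy_iff : InsolubleResidueReduction.InsolubleResidueAutomorphy ↔
    ∀ (K : Type) [Field K] [NumberField K] (n : ℕ) (hcpt : isCompact_glFiniteIntegralLevel n K), 0 < n →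
      ∀ (ι : PadicAlgCl 2 ≃+* ℂ) (ρ : FramedGaloisRep K (PadicAlgCl 2) n), ρ.toGaloisRep.IsIrreducible →
        IsResiduallyInsoluble ρ → IsPinnedGeometric ρ → IsUnramifiedAwayFromTwo ρ → IsResiduallyAutomorphic hcpt ι ρ :=
  Iff.rfl

/-- LART in vocabulary form. -/
theorem liftableResidueAutomorphy_iff : LiftableResidueAutomorphy ↔
    ∀ (K : Type) [Field K] [NumberField K] (n : ℕ) (hcpt : isCompact_glFiniteIntegralLevel n K), 0 < n →
      ∀ (ι : PadicAlgCl 2 ≃+* ℂ) (ρ : FramedGaloisRep K (PadicAlgCl 2) n), ρ.toGaloisRep.IsIrreducible →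
        IsResiduallyInsoluble ρ → IsArtinLiftableResidue ρ → IsPinnedGeometric ρ → IsUnramifiedAwayFromTwo ρ →
          IsResiduallyAutomorphic hcpt ι ρ :=
  Iff.rfl

/-- NLR in vocabulary form. -/
theorem nonLiftableResidueAutomorphy_iff : NonLiftableResidueAutomorphy ↔
    ∀ (K : Type) [Field K] [NumberField K] (n : ℕ) (hcpt : isCompact_glFiniteIntegralLevel n K), 0 < n →
      ∀ (ι : PadicAlgCl 2 ≃+* ℂ) (ρ : FramedGaloisRep K (PadicAlgCl 2) n), ρ.toGaloisRep.IsIrreducible →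
        IsResiduallyInsoluble ρ → ¬ IsArtinLiftableResidue ρ → IsPinnedGeometric ρ → IsUnramifiedAwayFromTwo ρ →
          IsResiduallyAutomorphic hcpt ι ρ :=
  Iff.rfl

/-- FRAME″ is literally `INS → Langlands`. -/
theorem insolubleResidueFrame_iff :
    InsolubleResidueFrame ↔ (InsolubleResidueReduction.InsolubleResidueAutomorphy → _root_.Langlands) :=
  Iff.rfl

/-- SAI in vocabulary form. -/
theorem insolubleStrongArtin_iff : InsolubleStrongArtin ↔
    ∀ (K : Type) [Field K] [NumberField K] (n : ℕ) (hcpt : isCompact_glFiniteIntegralLevel n K), 0 < n →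
      ∀ (ι : PadicAlgCl 2 ≃+* ℂ) (σ : FramedGaloisRep K (PadicAlgCl 2) n), (Set.range (fun g : Field.absoluteGaloisGroup K => σ g)).Finite →
        σ.toGaloisRep.IsIrreducible → ¬ IsSolvable (MonoidHom.range (σ : Field.absoluteGaloisGroup K →* GL (Fin n) (PadicAlgCl 2))) →
          ∃ π : CuspidalAutomorphicRepData n K hcpt, π.1.IsLAlgebraic ∧
            ∀ᶠ v : HeightOneSpectrum (𝓞 K) in cofinite, SatakeFrobCompatibleAt ι π.1 σ v :=
  Iff.rfl

/-! ## Dial lemmas: the kernel of ρ kills its residue; solubility descends to the residue; finite image ⇒ pinned-geometric -/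

omit [NumberField K] in
/-- If τ is a residual representation of σ : Γ_K → GL_n(ℚ̄_ℓ) then `ker σ ≤ ker τ` (σ g = 1 ⇒ the integral model is 1 at g ⇒ its
reduction is 1 ⇒ τ g = 1 by the kernel clause of `IsSemisimplificationOf`). [folklore] -/
theorem ker_le_ker_of_isResidualRepOf {k : Type} [Field k] {ι : padicAlgClResidueField ℓ →+* k}
    {σ : FramedGaloisRep K (PadicAlgCl ℓ) n} {τ : Field.absoluteGaloisGroup K →* GL (Fin n) k}
    (h : σ.IsResidualRepOf ι τ) :
    (σ : Field.absoluteGaloisGroup K →* GL (Fin n) (PadicAlgCl ℓ)).ker ≤ τ.ker := by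
  obtain ⟨τ₀, ⟨ρ₀, Q, ⟨P, hP⟩, hτ⟩, hss⟩ := h
  refine le_trans ?_ hss.2.2
  intro g hg
  rw [MonoidHom.mem_ker] at hg ⊢
  have h1 : Matrix.GeneralLinearGroup.map (padicAlgClIntegers ℓ).subtype (ρ₀ g) = 1 := by
    rw [hP g, hg, mul_one, inv_mul_cancel]
  have h2 : ρ₀ g = 1 := by
    ext i j
    have hij : (Matrix.GeneralLinearGroup.map (padicAlgClIntegers ℓ).subtype (ρ₀ g)) i j =
        (1 : GL (Fin n) (PadicAlgCl ℓ)) i j := by rw [h1]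
    rw [Matrix.GeneralLinearGroup.map_apply, ValuationSubring.subtype_apply] at hij
    rw [hij]
    simp only [Units.val_one]
    by_cases hd : i = j
    · subst hd; simp
    · simp [Matrix.one_apply_ne hd]
  have hred : integralReduction ι ρ₀ g = 1 := by
    change Matrix.GeneralLinearGroup.map (ι.comp (IsLocalRing.residue (padicAlgClIntegers ℓ))) (ρ₀ g) = 1
    rw [h2, map_one]
  rw [hτ g, hred, mul_one, mul_inv_cancel]

omit [NumberField K] in
/-- SOLUBILITY DESCENDS TO THE RESIDUE: if τ is a residual representation of σ and im σ is soluble then im τ is soluble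
(im τ ≅ Γ_K / ker τ is a quotient of Γ_K / ker σ ≅ im σ, `ker_le_ker_of_isResidualRepOf`). [folklore] -/
theorem isSolvable_range_of_isResidualRepOf {k : Type} [Field k] {ι : padicAlgClResidueField ℓ →+* k}
    {σ : FramedGaloisRep K (PadicAlgCl ℓ) n} {τ : Field.absoluteGaloisGroup K →* GL (Fin n) k}
    (h : σ.IsResidualRepOf ι τ)
    (hs : IsSolvable (MonoidHom.range (σ : Field.absoluteGaloisGroup K →* GL (Fin n) (PadicAlgCl ℓ)))) :
    IsSolvable τ.range := by
  have hker : (σ : Field.absoluteGaloisGroup K →* GL (Fin n) (PadicAlgCl ℓ)).ker ≤ τ.ker := ker_le_ker_of_isResidualRepOf h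
  generalize (σ : Field.absoluteGaloisGroup K →* GL (Fin n) (PadicAlgCl ℓ)) = σ' at hs hker
  haveI : IsSolvable σ'.range := hs
  haveI : IsSolvable (Field.absoluteGaloisGroup K ⧸ σ'.ker) :=
    solvable_of_solvable_injective (QuotientGroup.rangeKerLift_injective σ')
  have hker' : σ'.ker ≤ τ.rangeRestrict.ker := by
    rw [MonoidHom.ker_rangeRestrict]; exact hker
  have hψ : Function.Surjective (QuotientGroup.lift σ'.ker τ.rangeRestrict hker') := by
    intro y
    obtain ⟨g, rfl⟩ := τ.rangeRestrict_surjective y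
    exact ⟨QuotientGroup.mk g, QuotientGroup.lift_mk' _ hker' g⟩
  exact solvable_of_surjective hψ

omit [NumberField K] in
/-- An INSOLUBLE residue has only INSOLUBLE Artin lifts: if every residual representation of ρ has insoluble image and σ shares the
residual representation τ with ρ, then im σ is insoluble. -/
theorem not_isSolvable_range_of_lift {ρ σ : FramedGaloisRep K (PadicAlgCl 2) n}
    {τ : Field.absoluteGaloisGroup K →* GL (Fin n) (padicAlgClResidueField 2)}
    (hins : IsResiduallyInsoluble ρ) (hρ : ρ.IsResidualRepOf (RingHom.id _) τ) (hσ : σ.IsResidualRepOf (RingHom.id _) τ) :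
    ¬ IsSolvable (MonoidHom.range (σ : Field.absoluteGaloisGroup K →* GL (Fin n) (PadicAlgCl 2))) :=
  fun hs => hins τ hρ (isSolvable_range_of_isResidualRepOf hσ hs)

/-- The image of the local representation `σ|_{Γ_{K_v}}` lies in the image of `σ`. [folklore; as `SoloBlind.range_toLocal_subset`] -/
theorem range_toLocal_subset (σ : FramedGaloisRep K (PadicAlgCl ℓ) n) (v : HeightOneSpectrum (𝓞 K)) :
    Set.range (σ.toLocal v) ⊆ Set.range σ := by
  rintro _ ⟨g, rfl⟩
  exact ⟨_, (FramedGaloisRep.toLocal_apply v σ g).symm⟩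

/-- FINITE IMAGE ⇒ PINNED-GEOMETRIC (a.e. unramified: open kernel, `eventually_isUnramifiedAt_of_isOpen_ker`; de Rham above ℓ for
Fontaine's pinned datum: Hilbert 90, `fontainePstAdicCompletion_isDeRhamFramed_of_finite_range`), any ℓ — the content of the tree's
`SoloBlind.isGeometricFramed_of_finite_range`, read for the pinned datum. [cite: FontaineMazurGeometric1995, §1] -/
theorem isPinnedGeometric_of_finite_range (σ : FramedGaloisRep K (PadicAlgCl ℓ) n)
    (hfin : (Set.range (fun g : Field.absoluteGaloisGroup K => σ g)).Finite) : IsPinnedGeometric σ :=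
  ⟨σ.eventually_isUnramifiedAt_of_isOpen_ker (FramedRep.isOpen_ker_of_finite_range σ hfin),
    fun v hv => Literature.NumberTheory.PAdicHodge.fontainePstAdicCompletion_isDeRhamFramed_of_finite_range v ℓ hv (σ.toLocal v)
      (hfin.subset (range_toLocal_subset σ v))⟩

/-! ## Dial logic -/

omit [NumberField K] in
/-- The two cell dials are DISJOINT and EXHAUSTIVE (one excluded middle): LART reads `IsArtinLiftableResidue ρ`, NLR reads its negation. -/
theorem dial_dichotomy (ρ : FramedGaloisRep K (PadicAlgCl 2) n) : IsArtinLiftableResidue ρ ∨ ¬ IsArtinLiftableResidue ρ :=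
  em _

omit [NumberField K] in
/-- Disjointness of the two cells' dials (no ρ is asked of both). -/
theorem dial_disjoint (ρ : FramedGaloisRep K (PadicAlgCl 2) n) : ¬ (IsArtinLiftableResidue ρ ∧ ¬ IsArtinLiftableResidue ρ) :=
  fun h => h.2 h.1

/-- The residue of an Artin lift is a residue of ρ: the dial's τ witnesses `IsResiduallyInsoluble`'s quantifier (no junk: LART's σ and ρ
are tied through an honest common τ). -/
theorem IsArtinLiftableResidue.exists_sharedResidual {ρ : FramedGaloisRep K (PadicAlgCl 2) n} (h : IsArtinLiftableResidue ρ) :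
    ∃ (σ : FramedGaloisRep K (PadicAlgCl 2) n) (τ : Field.absoluteGaloisGroup K →* GL (Fin n) (padicAlgClResidueField 2)),
      IsPinnedGeometric σ ∧ σ.toGaloisRep.IsIrreducible ∧ ρ.IsResidualRepOf (RingHom.id _) τ ∧ σ.IsResidualRepOf (RingHom.id _) τ := by
  obtain ⟨σ, τ, hfin, hirr, hρ, hσ⟩ := h
  exact ⟨σ, τ, isPinnedGeometric_of_finite_range σ hfin, hirr, hρ, hσ⟩

/-! ## KERNEL I — exactness: INS ⟺ LART ∧ NLR (one excluded middle, pure logic) -/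

/-- INS ⟹ LART (drop the dial hypothesis). -/
theorem liftable_of_insoluble (hI : InsolubleResidueReduction.InsolubleResidueAutomorphy) : LiftableResidueAutomorphy :=
  fun K _ _ n hcpt hn ι ρ hirr hins _ hgeo hlvl => hI K n hcpt hn ι ρ hirr hins hgeo hlvl

/-- INS ⟹ NLR. -/
theorem nonLiftable_of_insoluble (hI : InsolubleResidueReduction.InsolubleResidueAutomorphy) : NonLiftableResidueAutomorphy :=
  fun K _ _ n hcpt hn ι ρ hirr hins _ hgeo hlvl => hI K n hcpt hn ι ρ hirr hins hgeo hlvl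

/-- LART ∧ NLR ⟹ INS: given ρ, decide whether its residue is Artin-liftable. -/
theorem insoluble_of_cells (hL : LiftableResidueAutomorphy) (hN : NonLiftableResidueAutomorphy) :
    InsolubleResidueReduction.InsolubleResidueAutomorphy := by
  rw [insolubleResidueAutomorphy_iff]
  intro K _ _ n hcpt hn ι ρ hirr hins hgeo hlvl
  by_cases hlift : IsArtinLiftableResidue ρ
  · exact (liftableResidueAutomorphy_iff.mp hL) K n hcpt hn ι ρ hirr hins hlift hgeo hlvl
  · exact (nonLiftableResidueAutomorphy_iff.mp hN) K n hcpt hn ι ρ hirr hins hlift hgeo hlvl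

/-- THE EXACT DECOMPOSITION of the node: INS ⟺ LART ∧ NLR. -/
theorem insolubleResidueAutomorphy_iff_cells :
    InsolubleResidueReduction.InsolubleResidueAutomorphy ↔ (LiftableResidueAutomorphy ∧ NonLiftableResidueAutomorphy) :=
  ⟨fun hI => ⟨liftable_of_insoluble hI, nonLiftable_of_insoluble hI⟩, fun h => insoluble_of_cells h.1 h.2⟩

/-- The same decomposition read on the tree twin `Residue.InsolubleResidueAutomorphy` (LevelOneDyadic part 10). -/
theorem insolubleResidueAutomorphy_twin_iff_cells :
    Residue.InsolubleResidueAutomorphy ↔ (LiftableResidueAutomorphy ∧ NonLiftableResidueAutomorphy) :=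
  insolubleResidueAutomorphy_iff_cells

/-! ## KERNEL II — necessity from the summit: Langlands ⟹ INS ⟹ each cell; the frame; Langlands ⟹ SAI -/

/-- NECESSITY: Langlands ⟹ INS (the born decl; through the landed `Residue.insoluble_of_langlands`). [kernel certificate] -/
theorem insoluble_of_langlands (hLg : _root_.Langlands) : InsolubleResidueReduction.InsolubleResidueAutomorphy :=
  Residue.insoluble_of_langlands hLg

/-- NECESSITY: Langlands ⟹ LART. [kernel certificate] -/
theorem liftable_of_langlands (hLg : _root_.Langlands) : LiftableResidueAutomorphy :=
  liftable_of_insoluble (insoluble_of_langlands hLg)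

/-- NECESSITY: Langlands ⟹ NLR. [kernel certificate] -/
theorem nonLiftable_of_langlands (hLg : _root_.Langlands) : NonLiftableResidueAutomorphy :=
  nonLiftable_of_insoluble (insoluble_of_langlands hLg)

/-- B₂ ⟹ LART and B₂ ⟹ NLR (the cells sit below the host crux B₂ 27523 as well). -/
theorem cells_of_dyadic (hB : MinimalLevelDescent.DyadicLevelOneAutomorphy) :
    LiftableResidueAutomorphy ∧ NonLiftableResidueAutomorphy :=
  insolubleResidueAutomorphy_iff_cells.mp (Residue.insoluble_of_dyadic hB)

/-- FRAME″ from the born route's three other deciding binders (content certificate: FRAME″ = route-Langlands-InsolubleResidueReduction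
below INS, through its gate-certified `closes`). -/
theorem frame_of_host (hAB : InsolubleResidueReduction.AbelianResidueAutomorphy) (hSOL : InsolubleResidueReduction.SolubleResidueAutomorphy)
    (hF : InsolubleResidueReduction.DyadicLevelOneFrame) : InsolubleResidueFrame :=
  fun hINS => InsolubleResidueReduction.closes hAB hSOL hINS hF

/-- FRAME″ from the grand-host route-Langlands-MinimalLevelDescent rev 3 (AB, SOL and its six binders below B₂, via the twin's `closes`). -/
theorem frame_of_grandhost (hAB : Residue.AbelianResidueAutomorphy) (hSOL : Residue.SolubleResidueAutomorphy)
    (hD : MinimalLevelDescent.LevelPrimeDescent) (hL : MinimalLevelDescent.AutomorphyLifting)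
    (hW : MinimalLevelDescent.SatakeAvatarExistence) (hP : MinimalLevelDescent.PadicMemberCompatibility)
    (hA : MinimalLevelDescent.CompatibilityAwayFromLR) (hR : MinimalLevelDescent.CanonicalReciprocityData) : InsolubleResidueFrame :=
  fun hINS => Residue.closes hAB hSOL hINS hD hL hW hP hA hR

/-- NECESSITY: Langlands ⟹ FRAME″ (trivially: a consequence of S used toward S). -/
theorem frame_of_langlands (hLg : _root_.Langlands) : InsolubleResidueFrame := fun _ => hLg

/-- NECESSITY: Langlands ⟹ SAI — conjunct (B) of the summit at ℓ = 2 on a finite-image (hence pinned-geometric) irreducible σ; the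
insolubility hypothesis is not used.  (The tree's `SoloBlind.exists_cuspidal_of_finite_range` is the same step with `Corresponds`.)
[kernel certificate] -/
theorem insolubleStrongArtin_of_langlands (hLg : _root_.Langlands) : InsolubleStrongArtin := by
  intro K _ _ n hcpt hn ι σ hfin hirr _
  obtain ⟨⟨Rec⟩, h⟩ := hLg K
  have hgeo := isPinnedGeometric_of_finite_range σ hfin
  obtain ⟨π, hπ, hcorr⟩ := (h Rec n hn hcpt).2 2 ι σ hirr ⟨hgeo.1, fun v hv => hgeo.2 v hv⟩
  exact ⟨π, hπ, hcorr.1⟩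

/-! ## KERNEL III′ — the certified reduction of the attackable cell: LART ⟸ SAI (insoluble strong Artin, characteristic 0)

Given ρ with an Artin-liftable insoluble residue: take the lift σ (finite image, irreducible, sharing τ with ρ); im σ is insoluble
(`not_isSolvable_range_of_lift`); SAI makes σ automorphic (Satake–Frobenius compatible a.e. with a cuspidal L-algebraic π); automorphic ⇒
residually automorphic with P = Q (`LevelOneDyadic.isResiduallyAutomorphic_of_satakeCompatible`); and residual automorphy passes from σ
to ρ along the common τ (KERNEL III `Residue.isResiduallyAutomorphic_of_sharedResidual`).  No level condition on σ is needed: INS asks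
for a congruence with SOME cuspidal π of any level. -/

/-- LART ⟸ SAI. -/
theorem liftableResidueAutomorphy_of_strongArtin (hSA : InsolubleStrongArtin) : LiftableResidueAutomorphy := by
  rw [liftableResidueAutomorphy_iff]
  intro K _ _ n hcpt hn ι ρ hirr hins hlift hgeo _
  obtain ⟨σ, τ, hfin, hirrσ, hρτ, hστ⟩ := hlift
  have haut := (insolubleStrongArtin_iff.mp hSA) K n hcpt hn ι σ hfin hirrσ (not_isSolvable_range_of_lift hins hρτ hστ)
  exact isResiduallyAutomorphic_of_sharedResidual hρτ hστ hgeo.1 (isResiduallyAutomorphic_of_satakeCompatible hcpt ι σ haut)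

/-- SAI ⟸ SAI≤2 ∧ SAI≥3 (the LART line's two stubs: the ICOSAHEDRAL rank — an insoluble finite irreducible subgroup of GL₂(ℚ̄₂) ≅ GL₂(ℂ)
has projective image A₅ (Klein) — and the higher ranks). -/
theorem insolubleStrongArtin_of_ranks (h2 : ∀ (K : Type) [Field K] [NumberField K] (n : ℕ) (hcpt : Literature.NumberTheory.Automorphic.isCompact_glFiniteIntegralLevel n K), 0 < n → ∀ (ι : PadicAlgCl 2 ≃+* ℂ) (σ : Literature.NumberTheory.GaloisRepresentations.FramedGaloisRep K (PadicAlgCl 2) n), (Set.range (fun g : Field.absoluteGaloisGroup K => σ g)).Finite → σ.toGaloisRep.IsIrreducible → ¬ IsSolvable (MonoidHom.range (σ : Field.absoluteGaloisGroup K →* GL (Fin n) (PadicAlgCl 2))) → n ≤ 2 → ∃ π : Literature.NumberTheory.Automorphic.CuspidalAutomorphicRepData n K hcpt, π.1.IsLAlgebraic ∧ ∀ᶠ v : IsDedekindDomain.HeightOneSpectrum (NumberField.RingOfIntegers K) in cofinite, Summit.Langlands.SatakeFrobCompatibleAt ι π.1 σ v) (h3 : ∀ (K : Type) [Field K] [NumberField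 K] (n : ℕ) (hcpt : Literature.NumberTheory.Automorphic.isCompact_glFiniteIntegralLevel n K), 0 < n → ∀ (ι : PadicAlgCl 2 ≃+* ℂ) (σ : Literature.NumberTheory.GaloisRepresentations.FramedGaloisRep K (PadicAlgCl 2) n), (Set.range (fun g : Field.absoluteGaloisGroup K => σ g)).Finite → σ.toGaloisRep.IsIrreducible → ¬ IsSolvable (MonoidHom.range (σ : Field.absoluteGaloisGroup K →* GL (Fin n) (PadicAlgCl 2))) → 3 ≤ n → ∃ π : Literature.NumberTheory.Automorphic.CuspidalAutomorphicRepData n K hcpt, π.1.IsLAlgebraic ∧ ∀ᶠ v : IsDedekindDomain.HeightOneSpectrum (NumberField.RingOfIntegers K) in cofinite, Summit.Langlands.SatakeFrobCompatibleAt ι π.1 σ v) : InsolubleStrongArtin := by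
  intro K _ _ n hcpt hn ι σ hfin hirr hins
  by_cases hn2 : n ≤ 2
  · exact h2 K n hcpt hn ι σ hfin hirr hins hn2
  · exact h3 K n hcpt hn ι σ hfin hirr hins (by omega)

/-- THE LINE OF LART (composition of its BC3 skeleton `line_LART.lean`, stubs as hypotheses): SAI≤2 → SAI≥3 → LART. -/
theorem liftableResidueAutomorphy_of_line (h2 : ∀ (K : Type) [Field K] [NumberField K] (n : ℕ) (hcpt : Literature.NumberTheory.Automorphic.isCompact_glFiniteIntegralLevel n K), 0 < n → ∀ (ι : PadicAlgCl 2 ≃+* ℂ) (σ : Literature.NumberTheory.GaloisRepresentations.FramedGaloisRep K (PadicAlgCl 2) n), (Set.range (fun g : Field.absoluteGaloisGroup K => σ g)).Finite → σ.toGaloisRep.IsIrreducible → ¬ IsSolvable (MonoidHom.range (σ : Field.absoluteGaloisGroup K →* GL (Fin n) (PadicAlgCl 2))) → n ≤ 2 → ∃ π : Literature.NumberTheory.Automorphic.CuspidalAutomorphicRepData n K hcpt, π.1.IsLAlgebraic ∧ ∀ᶠ v : IsDedekindDomain.HeightOneSpectrum (NumberField.RingOfIntegers K) in cofinite, Summit.Langlands.SatakeFrobCompatibleAt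 ι π.1 σ v) (h3 : ∀ (K : Type) [Field K] [NumberField K] (n : ℕ) (hcpt : Literature.NumberTheory.Automorphic.isCompact_glFiniteIntegralLevel n K), 0 < n → ∀ (ι : PadicAlgCl 2 ≃+* ℂ) (σ : Literature.NumberTheory.GaloisRepresentations.FramedGaloisRep K (PadicAlgCl 2) n), (Set.range (fun g : Field.absoluteGaloisGroup K => σ g)).Finite → σ.toGaloisRep.IsIrreducible → ¬ IsSolvable (MonoidHom.range (σ : Field.absoluteGaloisGroup K →* GL (Fin n) (PadicAlgCl 2))) → 3 ≤ n → ∃ π : Literature.NumberTheory.Automorphic.CuspidalAutomorphicRepData n K hcpt, π.1.IsLAlgebraic ∧ ∀ᶠ v : IsDedekindDomain.HeightOneSpectrum (NumberField.RingOfIntegers K) in cofinite, Summit.Langlands.SatakeFrobCompatibleAt ι π.1 σ v) : LiftableResidueAutomorphy :=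
  liftableResidueAutomorphy_of_strongArtin (insolubleStrongArtin_of_ranks h2 h3)

/-- The two LART line stubs are S-implied (they are SAI restricted by rank). [kernel certificate] -/
theorem lineStubs_of_langlands (hLg : _root_.Langlands) : (∀ (K : Type) [Field K] [NumberField K] (n : ℕ) (hcpt : Literature.NumberTheory.Automorphic.isCompact_glFiniteIntegralLevel n K), 0 < n → ∀ (ι : PadicAlgCl 2 ≃+* ℂ) (σ : Literature.NumberTheory.GaloisRepresentations.FramedGaloisRep K (PadicAlgCl 2) n), (Set.range (fun g : Field.absoluteGaloisGroup K => σ g)).Finite → σ.toGaloisRep.IsIrreducible → ¬ IsSolvable (MonoidHom.range (σ : Field.absoluteGaloisGroup K →* GL (Fin n) (PadicAlgCl 2))) → n ≤ 2 → ∃ π : Literature.NumberTheory.Automorphic.CuspidalAutomorphicRepData n K hcpt, π.1.IsLAlgebraic ∧ ∀ᶠ v : IsDedekindDomain.HeightOneSpectrum (NumberField.RingOfIntegers K) in cofinite, Summit.Langlands.SatakeFrobCompatibleAt ι π.1 σ v) ∧ (∀ (K : Type) [Field K] [NumberField K] (n : ℕ) (hcpt : Literature.NumberTheory.Automorphic.isCompact_glFiniteIntegralLevel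 n K), 0 < n → ∀ (ι : PadicAlgCl 2 ≃+* ℂ) (σ : Literature.NumberTheory.GaloisRepresentations.FramedGaloisRep K (PadicAlgCl 2) n), (Set.range (fun g : Field.absoluteGaloisGroup K => σ g)).Finite → σ.toGaloisRep.IsIrreducible → ¬ IsSolvable (MonoidHom.range (σ : Field.absoluteGaloisGroup K →* GL (Fin n) (PadicAlgCl 2))) → 3 ≤ n → ∃ π : Literature.NumberTheory.Automorphic.CuspidalAutomorphicRepData n K hcpt, π.1.IsLAlgebraic ∧ ∀ᶠ v : IsDedekindDomain.HeightOneSpectrum (NumberField.RingOfIntegers K) in cofinite, Summit.Langlands.SatakeFrobCompatibleAt ι π.1 σ v) :=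
  ⟨fun K _ _ n hcpt hn ι σ hfin hirr hins _ => insolubleStrongArtin_of_langlands hLg K n hcpt hn ι σ hfin hirr hins,
   fun K _ _ n hcpt hn ι σ hfin hirr hins _ => insolubleStrongArtin_of_langlands hLg K n hcpt hn ι σ hfin hirr hins⟩

/-! ## KERNEL IV — the birth skeleton of the residual NLR: the residue is absolutely irreducible | it is not -/

/-- NLR ⟸ NLR_irr ∧ NLR_red (composition of `birth_NLR.lean`, stubs as hypotheses; one excluded middle on `ρ.IsResiduallyAbsIrreducible`). -/
theorem nonLiftableResidueAutomorphy_of_birth (hirr : ∀ (K : Type) [Field K] [NumberField K] (n : ℕ) (hcpt : Literature.NumberTheory.Automorphic.isCompact_glFiniteIntegralLevel n K), 0 < n → ∀ (ι : PadicAlgCl 2 ≃+* ℂ) (ρ : Literature.NumberTheory.GaloisRepresentations.FramedGaloisRep K (PadicAlgCl 2) n), ρ.toGaloisRep.IsIrreducible → (∀ τ : Field.absoluteGaloisGroup K →* GL (Fin n) (Literature.NumberTheory.GaloisRepresentations.padicAlgClResidueField 2), ρ.IsResidualRepOf (RingHom.id (Literature.NumberTheory.GaloisRepresentations.padicAlgClResidueField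 2)) τ → ¬ IsSolvable τ.range) → ¬ (∃ (σ : Literature.NumberTheory.GaloisRepresentations.FramedGaloisRep K (PadicAlgCl 2) n) (τ : Field.absoluteGaloisGroup K →* GL (Fin n) (Literature.NumberTheory.GaloisRepresentations.padicAlgClResidueField 2)), (Set.range (fun g : Field.absoluteGaloisGroup K => σ g)).Finite ∧ σ.toGaloisRep.IsIrreducible ∧ ρ.IsResidualRepOf (RingHom.id (Literature.NumberTheory.GaloisRepresentations.padicAlgClResidueField 2)) τ ∧ σ.IsResidualRepOf (RingHom.id (Literature.NumberTheory.GaloisRepresentations.padicAlgClResidueField 2)) τ) → ρ.IsResiduallyAbsIrreducible → ((∀ᶠ v : IsDedekindDomain.HeightOneSpectrum (NumberField.RingOfIntegers K) in cofinite, ρ.IsUnramifiedAt v) ∧ ∀ (v : IsDedekindDomain.HeightOneSpectrum (NumberField.RingOfIntegers K)) (hv : ((2 : ℕ) : NumberField.RingOfIntegers K) ∈ v.asIdeal), (Literature.NumberTheory.PAdicHodge.fontainePstAdicCompletion v 2 hv).IsDeRhamFramed (ρ.toLocal v)) → (∀ v : IsDedekindDomain.HeightOneSpectrum (NumberField.RingOfIntegers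 K), ((2 : ℕ) : NumberField.RingOfIntegers K) ∉ v.asIdeal → ρ.IsUnramifiedAt v) → ∃ π : Literature.NumberTheory.Automorphic.CuspidalAutomorphicRepData n K hcpt, π.1.IsLAlgebraic ∧ ∀ᶠ v : IsDedekindDomain.HeightOneSpectrum (NumberField.RingOfIntegers K) in cofinite, ρ.IsUnramifiedAt v ∧ (∃ α : Multiset ℂ, π.1.HasSatakeParamAt v α) ∧ ∀ α : Multiset ℂ, π.1.HasSatakeParamAt v α → ∃ P Q : Polynomial (Valued.v : Valuation (PadicAlgCl 2) NNReal).valuationSubring, ρ.HasFrobCharpolyAt v (P.map (Valued.v : Valuation (PadicAlgCl 2) NNReal).valuationSubring.subtype) ∧ Literature.NumberTheory.Automorphic.arithFrobPolyOfSatake ι v.residueCard 1 α = Q.map (Valued.v : Valuation (PadicAlgCl 2) NNReal).valuationSubring.subtype ∧ P.map (IsLocalRing.residue (Valued.v : Valuation (PadicAlgCl 2) NNReal).valuationSubring) = Q.map (IsLocalRing.residue (Valued.v : Valuation (PadicAlgCl 2) NNReal).valuationSubring)) (hred : ∀ (K : Type) [Field K] [NumberField K] (n : ℕ) (hcpt :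 Literature.NumberTheory.Automorphic.isCompact_glFiniteIntegralLevel n K), 0 < n → ∀ (ι : PadicAlgCl 2 ≃+* ℂ) (ρ : Literature.NumberTheory.GaloisRepresentations.FramedGaloisRep K (PadicAlgCl 2) n), ρ.toGaloisRep.IsIrreducible → (∀ τ : Field.absoluteGaloisGroup K →* GL (Fin n) (Literature.NumberTheory.GaloisRepresentations.padicAlgClResidueField 2), ρ.IsResidualRepOf (RingHom.id (Literature.NumberTheory.GaloisRepresentations.padicAlgClResidueField 2)) τ → ¬ IsSolvable τ.range) → ¬ (∃ (σ : Literature.NumberTheory.GaloisRepresentations.FramedGaloisRep K (PadicAlgCl 2) n) (τ : Field.absoluteGaloisGroup K →* GL (Fin n) (Literature.NumberTheory.GaloisRepresentations.padicAlgClResidueField 2)), (Set.range (fun g : Field.absoluteGaloisGroup K => σ g)).Finite ∧ σ.toGaloisRep.IsIrreducible ∧ ρ.IsResidualRepOf (RingHom.id (Literature.NumberTheory.GaloisRepresentations.padicAlgClResidueField 2)) τ ∧ σ.IsResidualRepOf (RingHom.id (Literature.NumberTheory.GaloisRepresentations.padicAlgClResidueField 2)) τ) → ¬ ρ.IsResiduallyAbsIrreducible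 → ((∀ᶠ v : IsDedekindDomain.HeightOneSpectrum (NumberField.RingOfIntegers K) in cofinite, ρ.IsUnramifiedAt v) ∧ ∀ (v : IsDedekindDomain.HeightOneSpectrum (NumberField.RingOfIntegers K)) (hv : ((2 : ℕ) : NumberField.RingOfIntegers K) ∈ v.asIdeal), (Literature.NumberTheory.PAdicHodge.fontainePstAdicCompletion v 2 hv).IsDeRhamFramed (ρ.toLocal v)) → (∀ v : IsDedekindDomain.HeightOneSpectrum (NumberField.RingOfIntegers K), ((2 : ℕ) : NumberField.RingOfIntegers K) ∉ v.asIdeal → ρ.IsUnramifiedAt v) → ∃ π : Literature.NumberTheory.Automorphic.CuspidalAutomorphicRepData n K hcpt, π.1.IsLAlgebraic ∧ ∀ᶠ v : IsDedekindDomain.HeightOneSpectrum (NumberField.RingOfIntegers K) in cofinite, ρ.IsUnramifiedAt v ∧ (∃ α : Multiset ℂ, π.1.HasSatakeParamAt v α) ∧ ∀ α : Multiset ℂ, π.1.HasSatakeParamAt v α → ∃ P Q : Polynomial (Valued.v : Valuation (PadicAlgCl 2) NNReal).valuationSubring, ρ.HasFrobCharpolyAt v (P.map (Valued.v : Valuation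 (PadicAlgCl 2) NNReal).valuationSubring.subtype) ∧ Literature.NumberTheory.Automorphic.arithFrobPolyOfSatake ι v.residueCard 1 α = Q.map (Valued.v : Valuation (PadicAlgCl 2) NNReal).valuationSubring.subtype ∧ P.map (IsLocalRing.residue (Valued.v : Valuation (PadicAlgCl 2) NNReal).valuationSubring) = Q.map (IsLocalRing.residue (Valued.v : Valuation (PadicAlgCl 2) NNReal).valuationSubring)) : NonLiftableResidueAutomorphy := by
  intro K _ _ n hcpt hn ι ρ hρirr hins hnl hgeo hlvl
  by_cases habs : ρ.IsResiduallyAbsIrreducible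
  · exact hirr K n hcpt hn ι ρ hρirr hins hnl habs hgeo hlvl
  · exact hred K n hcpt hn ι ρ hρirr hins hnl habs hgeo hlvl

/-- The two NLR birth stubs are S-implied (NLR plus one hypothesis each). [kernel certificate] -/
theorem birthStubs_of_langlands (hLg : _root_.Langlands) : (∀ (K : Type) [Field K] [NumberField K] (n : ℕ) (hcpt : Literature.NumberTheory.Automorphic.isCompact_glFiniteIntegralLevel n K), 0 < n → ∀ (ι : PadicAlgCl 2 ≃+* ℂ) (ρ : Literature.NumberTheory.GaloisRepresentations.FramedGaloisRep K (PadicAlgCl 2) n), ρ.toGaloisRep.IsIrreducible → (∀ τ : Field.absoluteGaloisGroup K →* GL (Fin n) (Literature.NumberTheory.GaloisRepresentations.padicAlgClResidueField 2), ρ.IsResidualRepOf (RingHom.id (Literature.NumberTheory.GaloisRepresentations.padicAlgClResidueField 2)) τ → ¬ IsSolvable τ.range) → ¬ (∃ (σ : Literature.NumberTheory.GaloisRepresentations.FramedGaloisRep K (PadicAlgCl 2) n) (τ : Field.absoluteGaloisGroup K →* GL (Fin n) (Literature.NumberTheory.GaloisRepresentations.padicAlgClResidueField 2)), (Set.range (fun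 g : Field.absoluteGaloisGroup K => σ g)).Finite ∧ σ.toGaloisRep.IsIrreducible ∧ ρ.IsResidualRepOf (RingHom.id (Literature.NumberTheory.GaloisRepresentations.padicAlgClResidueField 2)) τ ∧ σ.IsResidualRepOf (RingHom.id (Literature.NumberTheory.GaloisRepresentations.padicAlgClResidueField 2)) τ) → ρ.IsResiduallyAbsIrreducible → ((∀ᶠ v : IsDedekindDomain.HeightOneSpectrum (NumberField.RingOfIntegers K) in cofinite, ρ.IsUnramifiedAt v) ∧ ∀ (v : IsDedekindDomain.HeightOneSpectrum (NumberField.RingOfIntegers K)) (hv : ((2 : ℕ) : NumberField.RingOfIntegers K) ∈ v.asIdeal), (Literature.NumberTheory.PAdicHodge.fontainePstAdicCompletion v 2 hv).IsDeRhamFramed (ρ.toLocal v)) → (∀ v : IsDedekindDomain.HeightOneSpectrum (NumberField.RingOfIntegers K), ((2 : ℕ) : NumberField.RingOfIntegers K) ∉ v.asIdeal → ρ.IsUnramifiedAt v) → ∃ π : Literature.NumberTheory.Automorphic.CuspidalAutomorphicRepData n K hcpt, π.1.IsLAlgebraic ∧ ∀ᶠ v : IsDedekindDomain.HeightOneSpectrum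 (NumberField.RingOfIntegers K) in cofinite, ρ.IsUnramifiedAt v ∧ (∃ α : Multiset ℂ, π.1.HasSatakeParamAt v α) ∧ ∀ α : Multiset ℂ, π.1.HasSatakeParamAt v α → ∃ P Q : Polynomial (Valued.v : Valuation (PadicAlgCl 2) NNReal).valuationSubring, ρ.HasFrobCharpolyAt v (P.map (Valued.v : Valuation (PadicAlgCl 2) NNReal).valuationSubring.subtype) ∧ Literature.NumberTheory.Automorphic.arithFrobPolyOfSatake ι v.residueCard 1 α = Q.map (Valued.v : Valuation (PadicAlgCl 2) NNReal).valuationSubring.subtype ∧ P.map (IsLocalRing.residue (Valued.v : Valuation (PadicAlgCl 2) NNReal).valuationSubring) = Q.map (IsLocalRing.residue (Valued.v : Valuation (PadicAlgCl 2) NNReal).valuationSubring)) ∧ (∀ (K : Type) [Field K] [NumberField K] (n : ℕ) (hcpt : Literature.NumberTheory.Automorphic.isCompact_glFiniteIntegralLevel n K), 0 < n → ∀ (ι : PadicAlgCl 2 ≃+* ℂ) (ρ : Literature.NumberTheory.GaloisRepresentations.FramedGaloisRep K (PadicAlgCl 2) n), ρ.toGaloisRep.IsIrreducible → (∀ τ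 : Field.absoluteGaloisGroup K →* GL (Fin n) (Literature.NumberTheory.GaloisRepresentations.padicAlgClResidueField 2), ρ.IsResidualRepOf (RingHom.id (Literature.NumberTheory.GaloisRepresentations.padicAlgClResidueField 2)) τ → ¬ IsSolvable τ.range) → ¬ (∃ (σ : Literature.NumberTheory.GaloisRepresentations.FramedGaloisRep K (PadicAlgCl 2) n) (τ : Field.absoluteGaloisGroup K →* GL (Fin n) (Literature.NumberTheory.GaloisRepresentations.padicAlgClResidueField 2)), (Set.range (fun g : Field.absoluteGaloisGroup K => σ g)).Finite ∧ σ.toGaloisRep.IsIrreducible ∧ ρ.IsResidualRepOf (RingHom.id (Literature.NumberTheory.GaloisRepresentations.padicAlgClResidueField 2)) τ ∧ σ.IsResidualRepOf (RingHom.id (Literature.NumberTheory.GaloisRepresentations.padicAlgClResidueField 2)) τ) → ¬ ρ.IsResiduallyAbsIrreducible → ((∀ᶠ v : IsDedekindDomain.HeightOneSpectrum (NumberField.RingOfIntegers K) in cofinite, ρ.IsUnramifiedAt v) ∧ ∀ (v : IsDedekindDomain.HeightOneSpectrum (NumberField.RingOfIntegers K)) (hv : ((2 : ℕ) : NumberField.RingOfIntegers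 K) ∈ v.asIdeal), (Literature.NumberTheory.PAdicHodge.fontainePstAdicCompletion v 2 hv).IsDeRhamFramed (ρ.toLocal v)) → (∀ v : IsDedekindDomain.HeightOneSpectrum (NumberField.RingOfIntegers K), ((2 : ℕ) : NumberField.RingOfIntegers K) ∉ v.asIdeal → ρ.IsUnramifiedAt v) → ∃ π : Literature.NumberTheory.Automorphic.CuspidalAutomorphicRepData n K hcpt, π.1.IsLAlgebraic ∧ ∀ᶠ v : IsDedekindDomain.HeightOneSpectrum (NumberField.RingOfIntegers K) in cofinite, ρ.IsUnramifiedAt v ∧ (∃ α : Multiset ℂ, π.1.HasSatakeParamAt v α) ∧ ∀ α : Multiset ℂ, π.1.HasSatakeParamAt v α → ∃ P Q : Polynomial (Valued.v : Valuation (PadicAlgCl 2) NNReal).valuationSubring, ρ.HasFrobCharpolyAt v (P.map (Valued.v : Valuation (PadicAlgCl 2) NNReal).valuationSubring.subtype) ∧ Literature.NumberTheory.Automorphic.arithFrobPolyOfSatake ι v.residueCard 1 α = Q.map (Valued.v : Valuation (PadicAlgCl 2) NNReal).valuationSubring.subtype ∧ P.map (IsLocalRing.residue (Valued.v : Valuation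 (PadicAlgCl 2) NNReal).valuationSubring) = Q.map (IsLocalRing.residue (Valued.v : Valuation (PadicAlgCl 2) NNReal).valuationSubring)) :=
  ⟨fun K _ _ n hcpt hn ι ρ hρirr hins hnl _ hgeo hlvl => nonLiftable_of_langlands hLg K n hcpt hn ι ρ hρirr hins hnl hgeo hlvl,
   fun K _ _ n hcpt hn ι ρ hρirr hins hnl _ hgeo hlvl => nonLiftable_of_langlands hLg K n hcpt hn ι ρ hρirr hins hnl hgeo hlvl⟩

/-- The BC5 rung of LART (plan-only stub `stub_rung_oddIcosahedralLift`: totally real K, rank 2, an odd icosahedral Artin lift of the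
residue — the Pilloni–Stroh sector) is an instance of LART, hence S-implied. [kernel certificate] -/
theorem rung_of_liftable (hL : LiftableResidueAutomorphy) : ∀ (K : Type) [Field K] [NumberField K] [NumberField.IsTotallyReal K] (hcpt : Literature.NumberTheory.Automorphic.isCompact_glFiniteIntegralLevel 2 K) (ι : PadicAlgCl 2 ≃+* ℂ) (ρ : Literature.NumberTheory.GaloisRepresentations.FramedGaloisRep K (PadicAlgCl 2) 2), ρ.toGaloisRep.IsIrreducible → (∀ τ : Field.absoluteGaloisGroup K →* GL (Fin 2) (Literature.NumberTheory.GaloisRepresentations.padicAlgClResidueField 2), ρ.IsResidualRepOf (RingHom.id (Literature.NumberTheory.GaloisRepresentations.padicAlgClResidueField 2)) τ → ¬ IsSolvable τ.range) → (∃ (σ : Literature.NumberTheory.GaloisRepresentations.FramedGaloisRep K (PadicAlgCl 2) 2) (τ : Field.absoluteGaloisGroup K →* GL (Fin 2) (Literature.NumberTheory.GaloisRepresentations.padicAlgClResidueField 2)), (Set.range (fun g : Field.absoluteGaloisGroup K => σ g)).Finite ∧ σ.toGaloisRep.IsIrreducible ∧ σ.IsOdd ∧ Literature.NumberTheory.GaloisRepresentations.IsIcosahedralType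 (σ : Field.absoluteGaloisGroup K →* GL (Fin 2) (PadicAlgCl 2)) ∧ ρ.IsResidualRepOf (RingHom.id (Literature.NumberTheory.GaloisRepresentations.padicAlgClResidueField 2)) τ ∧ σ.IsResidualRepOf (RingHom.id (Literature.NumberTheory.GaloisRepresentations.padicAlgClResidueField 2)) τ) → ((∀ᶠ v : IsDedekindDomain.HeightOneSpectrum (NumberField.RingOfIntegers K) in cofinite, ρ.IsUnramifiedAt v) ∧ ∀ (v : IsDedekindDomain.HeightOneSpectrum (NumberField.RingOfIntegers K)) (hv : ((2 : ℕ) : NumberField.RingOfIntegers K) ∈ v.asIdeal), (Literature.NumberTheory.PAdicHodge.fontainePstAdicCompletion v 2 hv).IsDeRhamFramed (ρ.toLocal v)) → (∀ v : IsDedekindDomain.HeightOneSpectrum (NumberField.RingOfIntegers K), ((2 : ℕ) : NumberField.RingOfIntegers K) ∉ v.asIdeal → ρ.IsUnramifiedAt v) → ∃ π : Literature.NumberTheory.Automorphic.CuspidalAutomorphicRepData 2 K hcpt, π.1.IsLAlgebraic ∧ ∀ᶠ v : IsDedekindDomain.HeightOneSpectrum (NumberField.RingOfIntegers K) in cofinite,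 ρ.IsUnramifiedAt v ∧ (∃ α : Multiset ℂ, π.1.HasSatakeParamAt v α) ∧ ∀ α : Multiset ℂ, π.1.HasSatakeParamAt v α → ∃ P Q : Polynomial (Valued.v : Valuation (PadicAlgCl 2) NNReal).valuationSubring, ρ.HasFrobCharpolyAt v (P.map (Valued.v : Valuation (PadicAlgCl 2) NNReal).valuationSubring.subtype) ∧ Literature.NumberTheory.Automorphic.arithFrobPolyOfSatake ι v.residueCard 1 α = Q.map (Valued.v : Valuation (PadicAlgCl 2) NNReal).valuationSubring.subtype ∧ P.map (IsLocalRing.residue (Valued.v : Valuation (PadicAlgCl 2) NNReal).valuationSubring) = Q.map (IsLocalRing.residue (Valued.v : Valuation (PadicAlgCl 2) NNReal).valuationSubring) :=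
  fun K _ _ _ hcpt ι ρ hirr hins ⟨σ, τ, hfin, hirrσ, _, _, hρτ, hστ⟩ hgeo hlvl =>
    hL K 2 hcpt two_pos ι ρ hirr hins ⟨σ, τ, hfin, hirrσ, hρτ, hστ⟩ hgeo hlvl

/-! ## KERNEL V — the deciding theorems -/

/-- `closes` of the child route `NonLiftableResidueReduction` (three binders: LART → NLR → FRAME″ → Langlands). -/
theorem closes_framed (hL : LiftableResidueAutomorphy) (hN : NonLiftableResidueAutomorphy) (hF : InsolubleResidueFrame) :
    _root_.Langlands :=
  hF (insoluble_of_cells hL hN)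

/-- `closes` over the PARENT route's binders: INS replaced by its two cells (five binders AB → SOL → LART → NLR → FRAME → Langlands). -/
theorem closes (hAB : InsolubleResidueReduction.AbelianResidueAutomorphy) (hSOL : InsolubleResidueReduction.SolubleResidueAutomorphy)
    (hL : LiftableResidueAutomorphy) (hN : NonLiftableResidueAutomorphy) (hF : InsolubleResidueReduction.DyadicLevelOneFrame) :
    _root_.Langlands :=
  InsolubleResidueReduction.closes hAB hSOL (insoluble_of_cells hL hN) hF

/-- `closes` over the GRAND-HOST route-Langlands-MinimalLevelDescent rev 3 (ten binders; B₂ = AB ∧ SOL ∧ (LART ∧ NLR)). -/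
theorem closes_host (hAB : Residue.AbelianResidueAutomorphy) (hSOL : Residue.SolubleResidueAutomorphy)
    (hL : LiftableResidueAutomorphy) (hN : NonLiftableResidueAutomorphy)
    (hD : MinimalLevelDescent.LevelPrimeDescent) (hLw : MinimalLevelDescent.AutomorphyLifting)
    (hW : MinimalLevelDescent.SatakeAvatarExistence) (hP : MinimalLevelDescent.PadicMemberCompatibility)
    (hA : MinimalLevelDescent.CompatibilityAwayFromLR) (hR : MinimalLevelDescent.CanonicalReciprocityData) : _root_.Langlands :=
  Residue.closes hAB hSOL (insoluble_of_cells hL hN) hD hLw hW hP hA hR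

/-- The grand-host's aside rung 27525 (B₂ over ℚ in rank 2) follows from AB ∧ SOL ∧ LART ∧ NLR. -/
theorem rung_of_cells (hAB : Residue.AbelianResidueAutomorphy) (hSOL : Residue.SolubleResidueAutomorphy)
    (hL : LiftableResidueAutomorphy) (hN : NonLiftableResidueAutomorphy) : MinimalLevelDescent.DyadicLevelOneRankTwoQ :=
  Residue.rung_of_cells hAB hSOL (insoluble_of_cells hL hN)

end Summit.Langlands.Langlands.Theorems.LevelOneDyadic.Liftable
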